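import Summits.QuantumAdvantage.QuantumAdvantage.Theorems.FanInRootDefs

/-!
# FanInRoot (2/11): annihilator certificates for bare cycles — the generic linearisation theorem `smallRing_of_certificate` and the seeds `(5,1)`, `(6,1)`

A degree-`≤ r` reader on the bare `k`-cycle is linearised by the Bravyi–Gosset–König sign-bit identity; a `Λ ⊆` odd class annihilating every (output × monomial of
degree `≤ r`) column with odd total sign bit refutes perfectness.  Tables from `exp/bare_tables.py` (GF(2) elimination), checked here by `decide`.
-/

set_option linter.dupNamespace false -- D-0017: single-problem summit ⇒ `QuantumAdvantage.QuantumAdvantage` by design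

namespace Summit.QuantumAdvantage.QuantumAdvantage.Theorems.FanInRoot

open Finset
open Summit.QuantumAdvantage.AdviceFreeQNC0
open Literature.Computability.QuantumComplexity
open Literature.Computability.QuantumComplexity.RingHLF
open Literature.Computability.MetaComplexity
open scoped Classical

/-! ### §6b Annihilator certificates for bare cycles: the generic linearisation theorem and five kernel-checked seeds -/

/-- Evaluation-sum functional `f ↦ Σ_{p ∈ s} f(β_p)` on cube functions (linear). -/
def evalSum {k T : ℕ} (pat : Fin T → Fin k → Bool) (s : Finset (Fin T)) : Smolensky.CubeFn (ZMod 2) k →ₗ[ZMod 2] ZMod 2 where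
  toFun f := ∑ p ∈ s, f (pat p)
  map_add' f g := by simp [Finset.sum_add_distrib]
  map_smul' a f := by simp [Finset.mul_sum]

/-- FanInRoot helper `evalSum_apply` (lens-1 g6 FanInRoot package; see the module docstring). -/
theorem evalSum_apply {k T : ℕ} (pat : Fin T → Fin k → Bool) (s : Finset (Fin T)) (f : Smolensky.CubeFn (ZMod 2) k) :
    evalSum pat s f = ∑ p ∈ s, f (pat p) := rfl

/-- If every monomial of degree `≤ r` takes the value `1` an EVEN number of times on `{β_p : p ∈ s}`, then so does (in `𝔽₂`-sum) every function of degree `≤ r`. -/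
theorem evalSum_eq_zero_of_lowDeg {k T r : ℕ} (pat : Fin T → Fin k → Bool) (s : Finset (Fin T))
    (heven : ∀ S : Finset (Fin k), S.card ≤ r → 2 ∣ (s.filter fun p => ∀ a ∈ S, pat p a = true).card)
    {f : Smolensky.CubeFn (ZMod 2) k} (hf : f ∈ Smolensky.lowDeg (ZMod 2) k r) :
    (∑ p ∈ s, f (pat p)) = 0 := by
  classical
  have hle : Smolensky.lowDeg (ZMod 2) k r ≤ LinearMap.ker (evalSum pat s) := by
    rw [Smolensky.lowDeg_eq_span, Submodule.span_le]
    rintro _ ⟨⟨S, hS⟩, rfl⟩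
    rw [SetLike.mem_coe, LinearMap.mem_ker, evalSum_apply]
    rw [Finset.sum_congr rfl (fun p _ => Smolensky.mono_apply (F := ZMod 2) S (pat p)), Finset.sum_boole]
    obtain ⟨m, hm⟩ := heven S hS
    rw [hm]; push_cast
    have : (2 : ZMod 2) = 0 := rfl
    rw [this, zero_mul]
  have := hle hf
  rwa [LinearMap.mem_ker, evalSum_apply] at this

/-- **GENERIC CERTIFICATE THEOREM.**  Tables `pat/J/sb/lam` over `T` odd-class patterns of the bare `k`-cycle with: `J_p ∈ K(β_p)`, `sb_p = ℓ_{β_p}(J_p)`,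
`Λ·sb` odd, and `Λ ⊥` every column `J_{·,j}·x_S` (`|S| ≤ r`)  ⟹  `r ∈ SmallRingLosesDeg k`.  [NEW; the linearisation — `Rel` on `β_p` forces `⟨J_p, w(β_p)⟩ ≡ sb_p`,
sum over `Λ`: the left side vanishes output by output (`evalSum_eq_zero_of_lowDeg`), the right side is `1`.] -/
theorem smallRing_of_certificate {k r T : ℕ} (pat : Fin T → Fin k → Bool) (J : Fin T → Fin k → Bool) (sb : Fin T → ℕ) (lam : Fin T → Bool)
    (hodd : ∀ p, OddZeros (pat p)) (hJ : ∀ p, InKernel (pat p) (J p)) (hsb : ∀ p, signBit (pat p) (J p) = sb p)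
    (hsble : ∀ p, sb p = 0 ∨ sb p = 1)
    (hlam_sb : (univ.filter fun p : Fin T => lam p = true ∧ sb p = 1).card % 2 = 1)
    (hlam_even : ∀ j : Fin k, ∀ S : Finset (Fin k), S.card ≤ r →
      2 ∣ (((univ.filter fun p : Fin T => lam p = true).filter fun p => J p j = true).filter fun p => ∀ a ∈ S, pat p a = true).card) :
    r ∈ SmallRingLosesDeg k := by
  classical
  intro w hw
  by_contra hno
  simp only [not_exists, not_and, not_not] at hno
  let Λf : Finset (Fin T) := univ.filter fun p : Fin T => lam p = true
  -- (1) the parity equation on each certificate pattern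
  have hE : ∀ p : Fin T, ((univ.filter fun j : Fin k => J p j = true ∧ w (pat p) j = true).card : ZMod 2) = (sb p : ZMod 2) := by
    intro p
    have h1 : dot2 (J p) (w (pat p)) = sb p := by rw [← hsb p]; exact hno (pat p) (hodd p) (J p) (hJ p)
    unfold dot2 at h1
    have h2 := congrArg (fun m : ℕ => (m : ZMod 2)) h1
    simpa only [ZMod.natCast_mod] using h2
  -- (2) right-hand side over Λ is 1
  have hR : (∑ p ∈ Λf, (sb p : ZMod 2)) = 1 := by
    have hsplit : ∀ p : Fin T, (sb p : ZMod 2) = if sb p = 1 then 1 else 0 := by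
      intro p; rcases hsble p with h | h <;> simp [h]
    rw [Finset.sum_congr rfl (fun p _ => hsplit p), ← Finset.sum_filter, Finset.sum_const, nsmul_eq_mul, mul_one, Finset.filter_filter]
    have h4 := congrArg (fun m : ℕ => (m : ZMod 2)) hlam_sb
    simpa only [ZMod.natCast_mod, Nat.cast_one] using h4
  -- (3) left-hand side over Λ vanishes output by output
  have hL : (∑ p ∈ Λf, ((univ.filter fun j : Fin k => J p j = true ∧ w (pat p) j = true).card : ZMod 2)) = 0 := by
    have hcard : ∀ p : Fin T, ((univ.filter fun j : Fin k => J p j = true ∧ w (pat p) j = true).card : ZMod 2)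
        = ∑ j : Fin k, (if J p j = true ∧ w (pat p) j = true then (1 : ZMod 2) else 0) := by
      intro p; rw [Finset.card_filter]; push_cast; rfl
    rw [Finset.sum_congr rfl (fun p _ => hcard p), Finset.sum_comm]
    refine Finset.sum_eq_zero fun j _ => ?_
    have hstep : (∑ p ∈ Λf, (if J p j = true ∧ w (pat p) j = true then (1 : ZMod 2) else 0))
        = ∑ p ∈ Λf.filter (fun p => J p j = true), (fun β : Fin k → Bool => if w β j = true then (1 : ZMod 2) else 0) (pat p) := by
      conv_rhs => rw [Finset.sum_filter]
      refine Finset.sum_congr rfl fun p _ => ?_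
      by_cases hJp : J p j = true
      · simp [hJp]
      · simp [hJp]
    rw [hstep]
    exact evalSum_eq_zero_of_lowDeg pat _ (fun S hS => by rw [Finset.filter_filter, ← Finset.filter_filter]; exact hlam_even j S hS) (hw j)
  have h01 : (∑ p ∈ Λf, ((univ.filter fun j : Fin k => J p j = true ∧ w (pat p) j = true).card : ZMod 2)) = ∑ p ∈ Λf, (sb p : ZMod 2) :=
    Finset.sum_congr rfl fun p _ => hE p
  rw [hL, hR] at h01
  exact zero_ne_one h01


/-! #### Seed `(k, r) = (5, 1)` (tables from `exp/bare_tables.py`) -/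
namespace Bare5_1

/-- Certificate table: the odd-class patterns `β_p` of the bare cycle, bit-packed (one row per pattern). [data, see `exp/bare_*.txt`] -/
def patRow : Fin 16 → ℕ :=
  ![0, 24, 20, 12, 18, 10, 6, 30, 17, 9, 5, 29, 3, 27, 23, 15]
/-- Certificate table: the kernel vectors `J_p ∈ K(β_p)`, bit-packed. [data] -/
def jRow : Fin 16 → ℕ :=
  ![31, 26, 23, 13, 30, 27, 22, 13, 21, 15, 29, 26, 11, 21, 11, 22]
/-- Certificate table: the sign bits `sb_p = ℓ_{β_p}(J_p)`. [data] -/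
def sb : Fin 16 → ℕ :=
  ![1, 0, 0, 0, 0, 0, 0, 0, 0, 0, 0, 0, 0, 0, 0, 0]
/-- Certificate table: the annihilator `Λ` (which patterns enter the parity contradiction). [data] -/
def lam : Fin 16 → Bool :=
  ![true, false, true, false, true, true, false, true, false, true, true, true, false, true, true, true]

/-- The `p`-th odd-class pattern as a Boolean vector (unpacked from `patRow`). -/
def pat (p : Fin 16) : Fin 5 → Bool := fun a => Nat.testBit (patRow p) a.val
/-- The `p`-th kernel vector as a Boolean vector (unpacked from `jRow`). -/
def J (p : Fin 16) : Fin 5 → Bool := fun j => Nat.testBit (jRow p) j.val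

/-- FanInRoot helper `pat_odd` (lens-1 g6 FanInRoot package; see the module docstring). -/
theorem pat_odd : ∀ p : Fin 16, OddZeros (pat p) := by unfold OddZeros; decide
/-- FanInRoot helper `J_mem` (lens-1 g6 FanInRoot package; see the module docstring). -/
theorem J_mem : ∀ p : Fin 16, InKernel (pat p) (J p) := by decide
/-- FanInRoot helper `sb_spec` (lens-1 g6 FanInRoot package; see the module docstring). -/
theorem sb_spec : ∀ p : Fin 16, signBit (pat p) (J p) = sb p := by decide
/-- FanInRoot helper `sb_le` (lens-1 g6 FanInRoot package; see the module docstring). -/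
theorem sb_le : ∀ p : Fin 16, sb p = 0 ∨ sb p = 1 := by decide
/-- FanInRoot helper `lam_sb` (lens-1 g6 FanInRoot package; see the module docstring). -/
theorem lam_sb : (univ.filter fun p : Fin 16 => lam p = true ∧ sb p = 1).card % 2 = 1 := by decide
set_option maxRecDepth 200000 in
set_option maxHeartbeats 4000000 in
/-- FanInRoot helper `lam_even` (lens-1 g6 FanInRoot package; see the module docstring). -/
theorem lam_even : ∀ j : Fin 5, ∀ S : Finset (Fin 5), S.card ≤ 1 →
    2 ∣ (((univ.filter fun p : Fin 16 => lam p = true).filter fun p => J p j = true).filter fun p => ∀ a ∈ S, pat p a = true).card := by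
  decide

end Bare5_1

/-- **SEED `1 ∈ SmallRingLosesDeg 5` (KERNEL-CHECKED).** -/
theorem smallRingLosesDeg_5_1 : 1 ∈ SmallRingLosesDeg 5 :=
  smallRing_of_certificate Bare5_1.pat Bare5_1.J Bare5_1.sb Bare5_1.lam Bare5_1.pat_odd Bare5_1.J_mem Bare5_1.sb_spec Bare5_1.sb_le Bare5_1.lam_sb Bare5_1.lam_even

/-! #### Seed `(k, r) = (6, 1)` (tables from `exp/bare_tables.py`) -/
namespace Bare6_1

/-- Certificate table: the odd-class patterns `β_p` of the bare cycle, bit-packed (one row per pattern). [data, see `exp/bare_*.txt`] -/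
def patRow : Fin 32 → ℕ :=
  ![32, 16, 8, 56, 4, 52, 44, 28, 2, 50, 42, 26, 38, 22, 14, 62, 1, 49, 41, 25, 37, 21, 13, 61, 35, 19, 11, 59, 7, 55, 47, 31]
/-- Certificate table: the kernel vectors `J_p ∈ K(β_p)`, bit-packed. [data] -/
def jRow : Fin 32 → ℕ :=
  ![21, 42, 21, 47, 42, 29, 58, 55, 21, 43, 21, 46, 43, 29, 59, 54, 42, 31, 58, 53, 23, 42, 23, 45, 62, 53, 46, 27, 61, 54, 45, 27]
/-- Certificate table: the sign bits `sb_p = ℓ_{β_p}(J_p)`. [data] -/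
def sb : Fin 32 → ℕ :=
  ![0, 0, 0, 1, 0, 1, 1, 1, 0, 1, 0, 1, 1, 1, 1, 0, 0, 1, 1, 1, 1, 0, 1, 0, 1, 1, 1, 0, 1, 0, 0, 0]
/-- Certificate table: the annihilator `Λ` (which patterns enter the parity contradiction). [data] -/
def lam : Fin 32 → Bool :=
  ![false, true, false, true, true, false, false, true, false, true, false, true, false, true, false, false, true, true, false, false, false,
    false, false, true, false, true, false, false, false, true, false, true]

/-- The `p`-th odd-class pattern as a Boolean vector (unpacked from `patRow`). -/
def pat (p : Fin 32) : Fin 6 → Bool := fun a => Nat.testBit (patRow p) a.val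
/-- The `p`-th kernel vector as a Boolean vector (unpacked from `jRow`). -/
def J (p : Fin 32) : Fin 6 → Bool := fun j => Nat.testBit (jRow p) j.val

/-- FanInRoot helper `pat_odd` (lens-1 g6 FanInRoot package; see the module docstring). -/
theorem pat_odd : ∀ p : Fin 32, OddZeros (pat p) := by unfold OddZeros; decide
/-- FanInRoot helper `J_mem` (lens-1 g6 FanInRoot package; see the module docstring). -/
theorem J_mem : ∀ p : Fin 32, InKernel (pat p) (J p) := by decide
/-- FanInRoot helper `sb_spec` (lens-1 g6 FanInRoot package; see the module docstring). -/
theorem sb_spec : ∀ p : Fin 32, signBit (pat p) (J p) = sb p := by decide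
/-- FanInRoot helper `sb_le` (lens-1 g6 FanInRoot package; see the module docstring). -/
theorem sb_le : ∀ p : Fin 32, sb p = 0 ∨ sb p = 1 := by decide
/-- FanInRoot helper `lam_sb` (lens-1 g6 FanInRoot package; see the module docstring). -/
theorem lam_sb : (univ.filter fun p : Fin 32 => lam p = true ∧ sb p = 1).card % 2 = 1 := by decide
set_option maxRecDepth 200000 in
set_option maxHeartbeats 4000000 in
/-- FanInRoot helper `lam_even` (lens-1 g6 FanInRoot package; see the module docstring). -/
theorem lam_even : ∀ j : Fin 6, ∀ S : Finset (Fin 6), S.card ≤ 1 →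
    2 ∣ (((univ.filter fun p : Fin 32 => lam p = true).filter fun p => J p j = true).filter fun p => ∀ a ∈ S, pat p a = true).card := by
  decide

end Bare6_1

/-- **SEED `1 ∈ SmallRingLosesDeg 6` (KERNEL-CHECKED).** -/
theorem smallRingLosesDeg_6_1 : 1 ∈ SmallRingLosesDeg 6 :=
  smallRing_of_certificate Bare6_1.pat Bare6_1.J Bare6_1.sb Bare6_1.lam Bare6_1.pat_odd Bare6_1.J_mem Bare6_1.sb_spec Bare6_1.sb_le Bare6_1.lam_sb Bare6_1.lam_even

end Summit.QuantumAdvantage.QuantumAdvantage.Theorems.FanInRoot
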